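import Mathlib.LinearAlgebra.Charpoly.BaseChange
import Mathlib.LinearAlgebra.FiniteDimensional.Basic
import Mathlib.Algebra.Field.Subfield.Basic
import Literature.AlgebraicGeometry.Motives.FrobeniusTraceProofs
import HarnessLib

/-!
# Endomorphisms all of whose powers have rational trace

A linear-algebra lemma used in the theory of algebraic correspondences (Lieberman 1968;
Kleiman, *Algebraic cycles and the Weil conjectures* (1968) §2, proof that conjecture `B(X)` is
independent of the polarisation; Kleiman, *The standard conjectures* (1994) §4): if an
endomorphism `g` of a finite-dimensional vector space over a field `K` of characteristic zero has
`Tr (gᵐ) ∈ ℚ` for all `m`, then its characteristic polynomial has rational coefficients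
(Newton's identities, here in the generating-function form
`(det (1 - tA))' = -det (1 - tA) · ∑ Tr (Aᵐ⁺¹) tᵐ` of
`Literature.AlgebraicGeometry.Motives.FrobeniusTrace.derivative_charpolyRev`), and consequently,
if `g` is invertible, `g⁻¹` is a polynomial in `g` **with rational coefficients**
(Cayley–Hamilton). In the application `g` is induced by an algebraic correspondence, the traces
are rational by the Lefschetz trace formula, and the conclusion makes `g⁻¹` algebraic.

## Main statements

* `Matrix.coeff_charpolyRev_mem_of_trace_pow_mem`: for a matrix `A` over a field of characteristic zero and a subfield
  `S ∋ Tr (Aᵐ⁺¹)` (all `m`), every coefficient of `det (1 - tA)` lies in `S`.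
* `Matrix.coeff_charpoly_mem_of_trace_pow_mem`: the same for the characteristic polynomial.
* `LinearMap.exists_inverse_eq_sum_smul_pow_of_trace_pow_mem`: for an invertible endomorphism
  `g` with `Tr (gᵐ⁺¹) ∈ S` for all `m`, there are `c₀, …, c_{d-1} ∈ S` with
  `(∑ cₘ gᵐ) ∘ g = id = g ∘ (∑ cₘ gᵐ)`.
* `LinearMap.exists_inverse_eq_sum_ratCast_smul_pow`: the case `S = ℚ`.

## References

* D. Lieberman, *Numerical and homological equivalence of algebraic cycles on Hodge manifolds*,
  Amer. J. Math. 90 (1968), 366–374 (the Cayley–Hamilton argument).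
* S. Kleiman, *Algebraic cycles and the Weil conjectures* (1968), §2.
-/

open Polynomial

namespace Literature.AlgebraicGeometry.Motives

section Matrix

variable {K : Type*} [Field K] [CharZero K] {ι : Type*} [Fintype ι] [DecidableEq ι]

/-- **Newton's identities, subfield form.** If all power traces `Tr (Aᵐ⁺¹)` of a square matrix
over a field of characteristic zero lie in a subfield `S`, then so do all coefficients of the
reversed characteristic polynomial `det (1 - tA)`: from `c' = -c · ∑ Tr (Aᵐ⁺¹) tᵐ`
(`FrobeniusTrace.derivative_charpolyRev`) one gets `(m + 1) c_{m+1} = -∑_{a+b=m} c_a Tr (Aᵇ⁺¹)`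
and concludes by induction (`c₀ = 1`). [folklore] -/
theorem Matrix.coeff_charpolyRev_mem_of_trace_pow_mem (S : Subfield K) (A : Matrix ι ι K)
    (hA : ∀ m : ℕ, (A ^ (m + 1)).trace ∈ S) (m : ℕ) : A.charpolyRev.coeff m ∈ S := by
  induction m using Nat.strong_induction_on with
  | _ m ih =>
    cases m with
    | zero =>
      rw [Polynomial.coeff_zero_eq_eval_zero, Matrix.eval_charpolyRev]
      exact one_mem S
    | succ m =>
      -- compare the coefficients of `tᵐ` in `c' = -(c * P)`
      have h := congrArg (PowerSeries.coeff (R := K) m) (FrobeniusTrace.derivative_charpolyRev A)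
      rw [PowerSeries.coeff_derivative, Polynomial.coeff_coe, map_neg, PowerSeries.coeff_mul]
        at h
      have hsum : ∑ p ∈ Finset.antidiagonal m, (PowerSeries.coeff (R := K) p.1)
          (A.charpolyRev : PowerSeries K) * (PowerSeries.coeff (R := K) p.2)
            (PowerSeries.mk fun m ↦ (A ^ (m + 1)).trace) ∈ S := by
        refine sum_mem fun p hp ↦ mul_mem ?_ ?_
        · rw [Polynomial.coeff_coe]
          exact ih p.1 (by have := Finset.mem_antidiagonal.mp hp; omega)
        · rw [PowerSeries.coeff_mk]
          exact hA p.2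
      have hm : ((m : K) + 1) ≠ 0 := by exact_mod_cast Nat.succ_ne_zero m
      have : A.charpolyRev.coeff (m + 1) = -(∑ p ∈ Finset.antidiagonal m,
          (PowerSeries.coeff (R := K) p.1) (A.charpolyRev : PowerSeries K) *
            (PowerSeries.coeff (R := K) p.2) (PowerSeries.mk fun m ↦ (A ^ (m + 1)).trace)) *
          ((m : K) + 1)⁻¹ := by
        rw [← h, mul_inv_cancel_right₀ hm]
      rw [this]
      refine mul_mem (neg_mem hsum) (inv_mem ?_)
      exact add_mem (natCast_mem S m) (one_mem S)

/-- If all power traces of a square matrix over a field of characteristic zero lie in a subfield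
`S`, then so do the coefficients of its characteristic polynomial (the reverse of `det (1 - tA)`,
`Matrix.reverse_charpoly`). [folklore] -/
theorem Matrix.coeff_charpoly_mem_of_trace_pow_mem (S : Subfield K) (A : Matrix ι ι K)
    (hA : ∀ m : ℕ, (A ^ (m + 1)).trace ∈ S) (m : ℕ) : A.charpoly.coeff m ∈ S := by
  by_cases hm : m ≤ Fintype.card ι
  · have h := Polynomial.coeff_reverse A.charpoly (Fintype.card ι - m)
    rw [Matrix.reverse_charpoly, Matrix.charpoly_natDegree_eq_dim,
      Polynomial.revAt_le (Nat.sub_le _ _), Nat.sub_sub_self hm] at h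
    rw [← h]
    exact Matrix.coeff_charpolyRev_mem_of_trace_pow_mem S A hA _
  · rw [Polynomial.coeff_eq_zero_of_natDegree_lt
      (by rw [Matrix.charpoly_natDegree_eq_dim]; omega)]
    exact zero_mem S

end Matrix

section LinearMap

variable {K : Type*} [Field K] [CharZero K] {V : Type*} [AddCommGroup V] [Module K V]
  [FiniteDimensional K V]

/-- If all power traces `Tr (gᵐ⁺¹)` of an endomorphism of a finite-dimensional vector space over a
field of characteristic zero lie in a subfield `S`, then so do the coefficients of its
characteristic polynomial. [folklore] -/
theorem LinearMap.coeff_charpoly_mem_of_trace_pow_mem (S : Subfield K) (g : V →ₗ[K] V)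
    (hg : ∀ m : ℕ, LinearMap.trace K V (g ^ (m + 1)) ∈ S) (m : ℕ) : g.charpoly.coeff m ∈ S := by
  classical
  let b := Module.finBasis K V
  rw [← LinearMap.charpoly_toMatrix g b]
  refine Matrix.coeff_charpoly_mem_of_trace_pow_mem S _ (fun m ↦ ?_) m
  rw [LinearMap.toMatrix_pow, ← LinearMap.trace_eq_matrix_trace K b]
  exact hg m

/-- **Cayley–Hamilton with coefficients in a subfield.** Let `g` be an *invertible* endomorphism
of a finite-dimensional vector space over a field `K` of characteristic zero all of whose power
traces `Tr (gᵐ⁺¹)` lie in a subfield `S`. Then `g⁻¹` is a polynomial in `g` with coefficients in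
`S`: there are `c₀, …, c_{d-1} ∈ S` (`d = dim V`) with `(∑ cₘ gᵐ) g = 1 = g (∑ cₘ gᵐ)`
(from `χ_g(g) = 0`, `χ_g ∈ S[t]` by `LinearMap.coeff_charpoly_mem_of_trace_pow_mem`, and
`χ_g(0) = ± det g ≠ 0`). This is the linear algebra behind Lieberman's lemma "the inverse of an
algebraic correspondence inducing an automorphism is algebraic". [folklore] -/
theorem LinearMap.exists_inverse_eq_sum_smul_pow_of_trace_pow_mem (S : Subfield K) (g : V →ₗ[K] V)
    (hunit : IsUnit g) (hg : ∀ m : ℕ, LinearMap.trace K V (g ^ (m + 1)) ∈ S) :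
    ∃ c : ℕ → K, (∀ m, c m ∈ S) ∧
      (∑ m ∈ Finset.range (Module.finrank K V), c m • g ^ m) * g = 1 ∧
      g * (∑ m ∈ Finset.range (Module.finrank K V), c m • g ^ m) = 1 := by
  set d := Module.finrank K V with hd
  set χ := g.charpoly with hχ
  have hcoeff : ∀ m, χ.coeff m ∈ S := LinearMap.coeff_charpoly_mem_of_trace_pow_mem S g hg
  have hdeg : χ.natDegree = d := LinearMap.charpoly_natDegree g
  have hmonic : χ.Monic := LinearMap.charpoly_monic g
  -- `χ(0) ≠ 0` since `det g ≠ 0`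
  have h0 : χ.coeff 0 ≠ 0 := by
    intro h0
    have hdet := LinearMap.det_eq_sign_charpoly_coeff g
    rw [← hχ, h0, mul_zero] at hdet
    exact ((LinearMap.isUnit_iff_isUnit_det g).mp hunit).ne_zero hdet
  -- Cayley–Hamilton: `∑_{m ≤ d} χₘ gᵐ = 0`, i.e. `(∑_{m < d} χ_{m+1} gᵐ) g = -χ₀`
  have hCH : (∑ m ∈ Finset.range d, χ.coeff (m + 1) • g ^ m) * g = -(χ.coeff 0 • 1) := by
    have h := LinearMap.aeval_self_charpoly g
    rw [Polynomial.aeval_eq_sum_range, ← hχ, hdeg, Finset.sum_range_succ', pow_zero] at h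
    rw [eq_neg_iff_add_eq_zero, ← h, Finset.sum_mul]
    congr 1
  have hl : (∑ m ∈ Finset.range d, (-(χ.coeff 0)⁻¹ * χ.coeff (m + 1)) • g ^ m) * g = 1 := by
    simp_rw [mul_smul, ← Finset.smul_sum, smul_mul_assoc, hCH, smul_neg, smul_smul, neg_mul,
      inv_mul_cancel₀ h0]
    simp
  refine ⟨fun m ↦ -(χ.coeff 0)⁻¹ * χ.coeff (m + 1), fun m ↦ ?_, hl, ?_⟩
  · exact mul_mem (neg_mem (inv_mem (hcoeff 0))) (hcoeff (m + 1))
  · -- a left inverse of an invertible element is a two-sided inverse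
    obtain ⟨u, rfl⟩ := hunit
    have : (∑ m ∈ Finset.range d, (-(χ.coeff 0)⁻¹ * χ.coeff (m + 1)) • (u : V →ₗ[K] V) ^ m) =
        ((u⁻¹ : (V →ₗ[K] V)ˣ) : V →ₗ[K] V) := by
      calc _ = (∑ m ∈ Finset.range d, (-(χ.coeff 0)⁻¹ * χ.coeff (m + 1)) • (u : V →ₗ[K] V) ^ m) *
            ((u : V →ₗ[K] V) * ((u⁻¹ : (V →ₗ[K] V)ˣ) : V →ₗ[K] V)) := by
              rw [Units.mul_inv, mul_one]
        _ = _ := by rw [← mul_assoc, hl, one_mul]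
    rw [this, Units.mul_inv]

/-- **The case `S = ℚ`.** An invertible endomorphism of a finite-dimensional vector space over a
field of characteristic zero all of whose powers have *rational* trace has an inverse which is a
polynomial in it with *rational* coefficients: `(∑ qₘ gᵐ) g = 1 = g (∑ qₘ gᵐ)`, `qₘ ∈ ℚ`
(Lieberman 1968; Kleiman 1968 §2; Kleiman 1994 §4). [cite: Kleiman1968AlgebraicCycles, §2] -/
theorem LinearMap.exists_inverse_eq_sum_ratCast_smul_pow (g : V →ₗ[K] V) (hunit : IsUnit g)
    (hg : ∀ m : ℕ, ∃ q : ℚ, LinearMap.trace K V (g ^ (m + 1)) = q) :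
    ∃ q : ℕ → ℚ,
      (∑ m ∈ Finset.range (Module.finrank K V), ((q m : ℚ) : K) • g ^ m) * g = 1 ∧
      g * (∑ m ∈ Finset.range (Module.finrank K V), ((q m : ℚ) : K) • g ^ m) = 1 := by
  obtain ⟨c, hc, h₁, h₂⟩ := LinearMap.exists_inverse_eq_sum_smul_pow_of_trace_pow_mem
    (Rat.castHom K).fieldRange g hunit (fun m ↦ by
      obtain ⟨q, hq⟩ := hg m
      exact RingHom.mem_fieldRange.mpr ⟨q, hq.symm⟩)
  choose q hq using fun m ↦ RingHom.mem_fieldRange.mp (hc m)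
  refine ⟨q, ?_, ?_⟩
  · convert h₁ using 3 with m
    exact congrArg (· • g ^ m) (hq m)
  · convert h₂ using 3 with m
    exact congrArg (· • g ^ m) (hq m)

end LinearMap

end Literature.AlgebraicGeometry.Motives
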